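import Literature.MathematicalPhysics.QuantumFieldTheory.Balaban1983to89.B11SectGSmoothCut

/-!
# `Balaban1983to89.B11SectGSmoothCutAdapters` — feeding LANDED sharp-block sup majorants into the smooth-partition class `BlockNorm.ofSmoothPartition`: the value
# bound under a sharp-block majorant, the ENLARGEMENT COST `e^{δr}` of reading an exponential kernel on the enlarged neighbourhood `N y ⊃ Δ(y)`, and the packaged
# majorant into the class from a block majorant (sup part) plus a pairwise bound (Hölder part)

[4] = T. Bałaban, *Propagators and renormalization transformations for lattice gauge theories. II*, Commun. Math. Phys. **96** (1984) 223–250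
[`Balaban1984PropagatorsII`]; [B9] = T. Bałaban, *Propagators for lattice gauge theories in a background field*, Commun. Math. Phys. **99** (1985) 389–434
[`Balaban1985BackgroundPropagators`].

statement-level skeleton of published theorems with citation tags; proofs where landed; nothing here is a claim about the
Yang–Mills mass gap

THE PRINTED LOCI.  [4] (2.51) p. 232 (block majorants), (2.54) p. 233 (the triangle inequality of the multiscale distance); [B9] (3.42)–(3.45) pp. 397–398
(sup entries on `x ∈ Δ(y)`, Hölder entries behind `ζ ∈ C₀^∞(Δ̃(y))` on the ENLARGED block — the passage `Δ(y) ↦ Δ̃(y)` costs a bounded factor in `e^{−δ₀d(y,y′)}`).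

WHY THIS FILE (cell `pub-ymgap`, node N06, width seat `pub-ymgap-dag-n06-w6` g2; sequel of `B11SectGSmoothCut` p636273, generic, no pin, no schema).  The
certificate's Theorem-3.3∕3.10-type sup entries are LANDED as localized majorants into sharp-block sup classes (`BlockNorm.ofBlocks`); the smooth-partition class reads
its sup part on the enlarged neighbourhood `N y`.  THIS FILE is the adapter:
* `abs_apply_le_of_hasMaj_ofBlocks` — under `HasMaj b₁ (ofBlocks blk) T K`, every value obeys `|(T μ)(x)| ≤ K(blk x, y′)·loc_{y′} μ`;
* `exp_kernel_enlarge` — `d(y, z) ≤ r` ⇒ `e^{−δd(z,y′)} ≤ e^{δr}·e^{−δd(y,y′)}` ((2.54), `δ ≥ 0`);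
* ★ `pointBound_enlarge_of_hasMaj_ofBlocks` — the `hpt` input of `B11SectGSmoothCut.hasMaj_into_ofSmoothPartition` from a sharp-block majorant `a·e^{−δd}` and the
  enlargement radius `N y x → d(y, blk x) ≤ r`: constant `a·e^{δr}`;
* ★★ `hasMaj_into_ofSmoothPartition_of_blockMaj` — packaged: sup part from the block majorant, Hölder part from a displayed pairwise bound `K₁`, majorant
  `W(y)·a·e^{δr}·e^{−δd} + K₁` into the class.
HONEST SCOPE.  Generic finite-dimensional bookkeeping; nothing of [4] or [B9] asserted; COUNT-NEUTRAL; N06 NOT discharged; nothing continuum, nothing about the mass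
gap.  Cell `pub-ymgap` (HUMAN RULING D-0062), Track A node N06 [B9], width seat `pub-ymgap-dag-n06-w6` (g2), 2026-08-28.
-/

noncomputable section

namespace Literature.MathematicalPhysics.QuantumFieldTheory.Balaban1983to89.B11SectGSmoothCutAdapters

open Finset B6RandomWalk
open B11SectG (BlockNorm HasMaj)
open B11SectGGlobal (Size HasMajG)
open B11SectGGlobalSizes
open B11SectGSmoothCut

variable {g : B6.Geometry} {X : Type} [Fintype X]
variable {F₁ : Type} [AddCommGroup F₁] [Module ℝ F₁]

/-- under a localized majorant INTO the sharp-block sup class every VALUE of the output is bounded: `|(T μ)(x)| ≤ K(blk x, y′)·loc_{y′} μ` for `μ` localized at `y′`.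
[cite: Balaban1984PropagatorsII, (2.51) p.232, bookkeeping] -/
theorem abs_apply_le_of_hasMaj_ofBlocks [DecidableEq g.Site] {b₁ : BlockNorm g F₁} {blk : X → g.Site} {T : F₁ →ₗ[ℝ] (X → ℝ)} {K : g.Site → g.Site → ℝ}
    (h : HasMaj b₁ (BlockNorm.ofBlocks g blk) T K) {y' : g.Site} {μ : F₁} (hμ : b₁.IsLoc y' μ) (x : X) :
    |T μ x| ≤ K (blk x) y' * b₁.loc y' μ := by
  have h1 : |T μ x| ≤ (Size.ofSup g (fun x y => blk x = y)).sz (blk x) (T μ) := ofSup_abs_le (fun x y => blk x = y) rfl (T μ)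
  rw [ofSup_blk_sz] at h1
  exact h1.trans (h y' μ hμ (blk x))

omit [Fintype X] in
/-- **THE ENLARGEMENT COST**: by the triangle inequality (2.54), `d(y, z) ≤ r` gives `e^{−δd(z,y′)} ≤ e^{δr}·e^{−δd(y,y′)}` (`δ ≥ 0`) — reading an exponential kernel
at a block `z` of the enlarged neighbourhood of `y` costs the factor `e^{δr}`. [cite: Balaban1984PropagatorsII, (2.54) p.233; Balaban1985BackgroundPropagators, (3.43) p.398 («Δ̃(y)»), bookkeeping] -/
theorem exp_kernel_enlarge (htri : Triangle254 g) {δ r : ℝ} (hδ : 0 ≤ δ) {y z y' : g.Site} (hz : g.dist y z ≤ r) :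
    Real.exp (-(δ * g.dist z y')) ≤ Real.exp (δ * r) * Real.exp (-(δ * g.dist y y')) := by
  rw [← Real.exp_add]
  refine Real.exp_le_exp.mpr ?_
  have h1 := htri y z y'
  have h2 : δ * g.dist y y' ≤ δ * g.dist y z + δ * g.dist z y' := by nlinarith
  have h3 : δ * g.dist y z ≤ δ * r := mul_le_mul_of_nonneg_left hz hδ
  linarith

/-- ★ **THE `hpt` INPUT OF `hasMaj_into_ofSmoothPartition` FROM A SHARP-BLOCK MAJORANT**: if `T` has the localized majorant `a·e^{−δd}` into the sharp-block sup class
and the neighbourhoods are enlarged blocks of radius `r` (`N y x → d(y, blk x) ≤ r`), then `|(T μ)(x)| ≤ a·e^{δr}·e^{−δd(y,y′)}·loc_{y′} μ` for every `x ∈ N y`.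
[cite: Balaban1984PropagatorsII, (2.51) p.232 + (2.54) p.233; Balaban1985BackgroundPropagators, (3.42)–(3.43) pp.397–398] -/
theorem pointBound_enlarge_of_hasMaj_ofBlocks [DecidableEq g.Site] (htri : Triangle254 g) {N : g.Site → X → Prop} {b₁ : BlockNorm g F₁} {blk : X → g.Site}
    {T : F₁ →ₗ[ℝ] (X → ℝ)} {a δ r : ℝ} (ha : 0 ≤ a) (hδ : 0 ≤ δ)
    (h : HasMaj b₁ (BlockNorm.ofBlocks g blk) T (fun z y' => a * Real.exp (-(δ * g.dist z y')))) (hN : ∀ y x, N y x → g.dist y (blk x) ≤ r) :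
    ∀ (y' : g.Site) (μ : F₁), b₁.IsLoc y' μ → ∀ (y : g.Site) (x : X), N y x →
      |T μ x| ≤ (a * Real.exp (δ * r) * Real.exp (-(δ * g.dist y y'))) * b₁.loc y' μ := by
  intro y' μ hμ y x hx
  refine (abs_apply_le_of_hasMaj_ofBlocks h hμ x).trans (mul_le_mul_of_nonneg_right ?_ (b₁.loc_nonneg _ _))
  calc a * Real.exp (-(δ * g.dist (blk x) y')) ≤ a * (Real.exp (δ * r) * Real.exp (-(δ * g.dist y y'))) :=
        mul_le_mul_of_nonneg_left (exp_kernel_enlarge htri hδ (hN y x hx)) ha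
    _ = _ := by ring

/-- ★★ **PACKAGED: A MAJORANT INTO THE SMOOTH-PARTITION CLASS FROM A BLOCK MAJORANT (sup part) AND A PAIRWISE BOUND (Hölder part)** — the sup entry of a landed
Theorem-3.3-type letter (`a·e^{−δd}` into the sharp blocks) and a displayed (3.43)-type pair estimate `K₁` give the majorant `W(y)·a·e^{δr}·e^{−δd(y,y′)} + K₁(y,y′)`
into `BlockNorm.ofSmoothPartition`. [cite: Balaban1985BackgroundPropagators, (3.42)–(3.45) pp.397–398; Balaban1984PropagatorsII, (2.51) p.232 + (2.54) p.233] -/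
theorem hasMaj_into_ofSmoothPartition_of_blockMaj [DecidableEq g.Site] (htri : Triangle254 g) {N : g.Site → X → Prop} [∀ y x, Decidable (N y x)]
    {P : X → X → Prop} [DecidableRel P] {w : X → X → ℝ} {hw : ∀ z z', 0 ≤ w z z'} {W : g.Site → ℝ} {hW : ∀ y, 0 ≤ W y} {ζ : g.Site → X → ℝ} {Λ : ℝ}
    {hΛ : 0 ≤ Λ} {hsum : ∀ x, ∑ y : g.Site, ζ y x = 1} {h0 : ∀ y x, 0 ≤ ζ y x} {h1 : ∀ y x, ζ y x ≤ 1} {hsupp : ∀ y x, ¬ N y x → ζ y x = 0}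
    {hLip : ∀ y x x', N y x → P x x' → w x x' * |ζ y x - ζ y x'| ≤ Λ * W y}
    {b₁ : BlockNorm g F₁} {blk : X → g.Site} {T : F₁ →ₗ[ℝ] (X → ℝ)} {a δ r : ℝ} {K₁ : g.Site → g.Site → ℝ} (ha : 0 ≤ a) (hδ : 0 ≤ δ) (hK₁ : ∀ a b, 0 ≤ K₁ a b)
    (h : HasMaj b₁ (BlockNorm.ofBlocks g blk) T (fun z y' => a * Real.exp (-(δ * g.dist z y')))) (hN : ∀ y x, N y x → g.dist y (blk x) ≤ r)
    (hpr : ∀ (y' : g.Site) (μ : F₁), b₁.IsLoc y' μ → ∀ (y : g.Site) (x x' : X), N y x → P x x' → w x x' * |T μ x - T μ x'| ≤ K₁ y y' * b₁.loc y' μ) :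
    HasMaj b₁ (BlockNorm.ofSmoothPartition N P w hw W hW ζ Λ hΛ hsum h0 h1 hsupp hLip) T
      (fun y y' => W y * (a * Real.exp (δ * r) * Real.exp (-(δ * g.dist y y'))) + K₁ y y') :=
  hasMaj_into_ofSmoothPartition (fun _ _ => mul_nonneg (mul_nonneg ha (Real.exp_nonneg _)) (Real.exp_nonneg _)) hK₁
    (pointBound_enlarge_of_hasMaj_ofBlocks htri ha hδ h hN) hpr

end Literature.MathematicalPhysics.QuantumFieldTheory.Balaban1983to89.B11SectGSmoothCutAdapters
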